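/-
Copyright (c) 2026 the pub-hodgecm-mathlib formalisation cell (harness21).  Prover seat hodgecm-mathlib-LH4-p13 (g8), req620 Track A «(D-RAM) FOUR-FRAME» squad, tier 0,
STAGE-1b (dealer LH4-plan (g13) WORD #91 «B2b-2»; MEMO-B2b2-gluedClassSet v1 65e7cd47 §3 «the cheap way round the shear»): brick (L-lab-20d) «RE-AVERAGING THE CLASS-SIGN
COUNT OVER A SMALLER SUBGROUP»: the labelled odd count of ★ (L-lab-20b), summed over a transversal `R₀` of `S_F ∕ N₀` for ANY subgroup `N₀ ≤ N′ = N(S̃′(M₀))` — e.g. the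
PRODUCT-shaped norm subgroup of the glued representative — at the price of the explicit multiplicity `k = #(R₀ ∩ N′) = [N′ : N₀]`.  2026-09-04.
-/
import Summits.HodgeConjecture.HodgeConjecture.Theorems.F0P3cDyRamLabelledOddClassSignRead   -- ★ p860516 (this seat, (L-lab-20b)): `two_mul_labelledOddCount_eq_sum_of_classSign`, `classSign_mul_eq_of_label`; brings ★ g36, ★ p860257 DEFS
import HarnessLib

/-!
# Crux `H413`, line LH4 «(D-RAM) FOUR-FRAME», STAGE-1b — (L-lab-20d) «RE-AVERAGING THE CLASS-SIGN COUNT OVER A SMALLER SUBGROUP `N₀ ≤ N(S̃′)`»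

Cell `hodgecm-mathlib` (D-0151), FLOOR 0, crux item H413 = `stmt-HodgeConjecture-24833`, route of record `HCCMUnconditional`; squad F0∕P3c∕LH4.  THEOREMS ONLY (no `def`, no
instance, no notation, no `sorry`, default heartbeats), ★-only imports, lane `--supports stmt-HodgeConjecture-24833`.

WHY.  ★ (L-lab-20b) evaluates `2·m^Λ_i(M₀)` over a transversal `R` of `S_F ∕ N′`, `N′ = N(S̃′(M₀))`.  For the glued representative `V(1,1,g)` the subgroup `N′` is SHEARED
(MEMO-B2b2-gluedClassSet v1 §2: the `E¹`-ambiguity puts `1 + (1+g)g⁻²N(ζ−1)` into `N′`), so a product-shaped transversal is not available by name — but a transversal `R₀` of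
`S_F ∕ N₀` for a PRODUCT subgroup `N₀ ≤ N′` is (three F-side representative systems).  This file moves the sum to `R₀`:
* §1 `sum_transversal_eq_card_mul_sum_transversal` — generic: for subgroups `N₀ ≤ N′ ≤ S` of a commutative group, transversals `R₀ ⊆ S` of `S ∕ N₀` and `R ⊆ S` of `S ∕ N′`
  (Finset currency: `∀ u ∈ S, ∃! r ∈ R, u⁻¹r ∈ N′`, same for `R₀, N₀`) and an `N′`-invariant `F`: `Σ_{r ∈ R₀} F r = #(R₀ ∩ N′) · Σ_{r ∈ R} F r` (fibrewise over the
  `R`-representative; every fibre has `#(R₀ ∩ N′)` elements by the translation bijection).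
* §2 HEAD **`two_mul_card_mul_labelledOddCount_eq_sum_of_classSign`** — ★ (L-lab-20b)'s setting + `N₀ ≤ N′` + transversals `R₀` (of `N₀`) and `R` (of `N′`):
  `2 · #(R₀ ∩ N′) · labelledOddCount σ ϖ tv i Λ M₀ = ω(D_{1,i}) · Σ_{r ∈ R₀} ω(r_i)·(1 + λ(r))`  (`#(R₀ ∩ N′) = [N′ : N₀]`; with `[𝒰 : N′]·[N′ : N₀] = [𝒰 : N₀]` the TABLE's
  `m^L_i ∕ [𝒰 : N′]` becomes `ω(D_{1,i})·Σ_{R₀}(…) ∕ (2[𝒰 : N₀])` — product indices only).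

HONEST LABEL: count-neutral finite-group bookkeeping; nothing summed to `0`.  HC_CM remains proved only modulo the printed citations (2 remaining named inputs: hLiu418 =
`stmt-HodgeConjecture-24832`, h413 = `stmt-HodgeConjecture-24833`) until rung 0 closes.
-/

noncomputable section

namespace Summit.HodgeConjecture.HodgeConjecture.Cruxes.H413.F0P3cDyRamLabelledOddClassSignSubgroup

open Literature.NumberTheory.Automorphic Literature.NumberTheory.Automorphic.HermitianLattice
open Literature.NumberTheory.Automorphic.UnitaryLatticeTree Literature.NumberTheory.Automorphic.UnitaryThreeFourFrame
open Summit.HodgeConjecture.HodgeConjecture.Cruxes.H413.F0P3cDyRamFourFramePieces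
open Summit.HodgeConjecture.HodgeConjecture.Cruxes.H413.F0P3cDyRamDiagonalTorusDefs
open Summit.HodgeConjecture.HodgeConjecture.Cruxes.H413.F0P3cDyRamLabelledOddCountDefs
open Summit.HodgeConjecture.HodgeConjecture.Cruxes.H413.F0P3cDyRamDiagonalKappaCountEval (fixed_of_mem_fixedUnitStabilizer)
open Summit.HodgeConjecture.HodgeConjecture.Cruxes.H413.F0P3cDyRamLabelledOddOneSlotRead (normSign_mul_eq_of_mem_map_unitNormMap)
open Summit.HodgeConjecture.HodgeConjecture.Cruxes.H413.F0P3cDyRamLabelledOddClassSignRead (two_mul_labelledOddCount_eq_sum_of_classSign)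
open scoped Valued WithZero Matrix MatrixGroups

/-! ## §1  Generic: a transversal of a smaller subgroup over-counts an invariant sum by the relative index -/

section Generic

variable {G : Type*} [CommGroup G]

open Classical in
/-- **RE-AVERAGING OVER A SMALLER SUBGROUP.**  `N₀ ≤ N′` subgroups of a commutative group (inside an ambient subgroup `S`); `R ⊆ S` a transversal of `S ∕ N′` and `R₀ ⊆ S` one of `S ∕ N₀` (as Finsets:
`∀ u ∈ S, ∃! r ∈ R, u⁻¹r ∈ N′`, resp. `N₀`); `F` constant on `N′`-cosets inside `S`.  Then `Σ_{r ∈ R₀} F r = #(R₀ ∩ N′) · Σ_{r ∈ R} F r` — sum fibrewise over the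
`R`-representative; each fibre is carried bijectively onto `R₀ ∩ N′` by `r ↦ rep₀(r·rb⁻¹)`. [cite: Serre1979, Ch. VI §1] [cite: LanglandsShelstad1987, §3] -/
theorem sum_transversal_eq_card_mul_sum_transversal {S N' N₀ : Subgroup G} (hN₀ : N₀ ≤ N')
    (R : Finset G) (hRS : ∀ r ∈ R, r ∈ S) (hR : ∀ u ∈ S, ∃! r, r ∈ R ∧ u⁻¹ * r ∈ N')
    (R₀ : Finset G) (hR₀S : ∀ r ∈ R₀, r ∈ S) (hR₀ : ∀ u ∈ S, ∃! r, r ∈ R₀ ∧ u⁻¹ * r ∈ N₀)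
    (F : G → ℤ) (hF : ∀ u ∈ S, ∀ n ∈ N', F (u * n) = F u) :
    ∑ r ∈ R₀, F r = ((R₀.filter fun r => r ∈ N').card : ℤ) * ∑ r ∈ R, F r := by
  classical
  -- the `N′`-representative in `R` and the `N₀`-representative in `R₀`
  have hrep : ∀ u ∈ S, ∃ r, r ∈ R ∧ u⁻¹ * r ∈ N' := fun u hu => (hR u hu).exists
  choose! rep hrepR hrepN using hrep
  have hrep_uniq : ∀ u ∈ S, ∀ r ∈ R, u⁻¹ * r ∈ N' → r = rep u := fun u hu r hr hrn =>
    (hR u hu).unique ⟨hr, hrn⟩ ⟨hrepR u hu, hrepN u hu⟩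
  have hrep₀ : ∀ u ∈ S, ∃ r, r ∈ R₀ ∧ u⁻¹ * r ∈ N₀ := fun u hu => (hR₀ u hu).exists
  choose! rep₀ hrep₀R hrep₀N using hrep₀
  have hrep₀_uniq : ∀ u ∈ S, ∀ r ∈ R₀, u⁻¹ * r ∈ N₀ → r = rep₀ u := fun u hu r hr hrn =>
    (hR₀ u hu).unique ⟨hr, hrn⟩ ⟨hrep₀R u hu, hrep₀N u hu⟩
  -- `rep` is constant on `N′`-cosets: `rep (u·n) = rep u`
  have hrep_eq_of : ∀ u ∈ S, ∀ u' ∈ S, u⁻¹ * u' ∈ N' → rep u' = rep u := fun u hu u' hu' h => by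
    refine hrep_uniq u hu _ (hrepR u' hu') ?_
    have : u⁻¹ * rep u' = (u⁻¹ * u') * (u'⁻¹ * rep u') := by group
    rw [this]; exact mul_mem h (hrepN u' hu')
  have hrep_self : ∀ r ∈ R, rep r = r := fun r hr => (hrep_uniq r (hRS r hr) r hr (by rw [inv_mul_cancel]; exact one_mem _)).symm
  have hrep₀_self : ∀ r ∈ R₀, rep₀ r = r := fun r hr => (hrep₀_uniq r (hR₀S r hr) r hr (by rw [inv_mul_cancel]; exact one_mem _)).symm
  have hk1 : ∀ A B X : G, (A * X) * (B * X)⁻¹ = A * B⁻¹ := fun A B X => by group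
  have hk2 : ∀ a b x : G, (a * x⁻¹)⁻¹ * (b * x⁻¹) = a⁻¹ * b := fun a b x => by
    rw [mul_comm a, mul_comm b, mul_inv_rev, inv_inv, mul_assoc, mul_inv_cancel_left]
  -- fibrewise
  rw [← Finset.sum_fiberwise_of_maps_to (s := R₀) (t := R) (g := rep) fun r hr => hrepR r (hR₀S r hr)]
  have hfib : ∀ rb ∈ R, ∑ r ∈ R₀ with rep r = rb, F r = ((R₀.filter fun r => r ∈ N').card : ℤ) * F rb := by
    intro rb hrb
    have hrbS := hRS rb hrb
    -- `F` is constant `= F rb` on the fibre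
    have hconst : ∀ r ∈ R₀.filter (fun r => rep r = rb), F r = F rb := by
      intro r hr
      rw [Finset.mem_filter] at hr
      obtain ⟨hr, hrr⟩ := hr
      have hn : r⁻¹ * rb ∈ N' := by rw [← hrr]; exact hrepN r (hR₀S r hr)
      have h := hF r (hR₀S r hr) _ hn
      rw [mul_inv_cancel_left] at h
      exact h.symm
    rw [Finset.sum_congr rfl hconst, Finset.sum_const, nsmul_eq_mul]
    congr 1
    -- the fibre is in bijection with `R₀ ∩ N′` via `r ↦ rep₀ (r·rb⁻¹)`
    refine congrArg Nat.cast (Finset.card_bij (fun r _ => rep₀ (r * rb⁻¹)) (fun r hr => ?_) (fun r₁ hr₁ r₂ hr₂ h => ?_) (fun r' hr' => ?_))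
    · rw [Finset.mem_filter] at hr ⊢
      obtain ⟨hr, hrr⟩ := hr
      have hS : r * rb⁻¹ ∈ S := mul_mem (hR₀S r hr) (inv_mem hrbS)
      refine ⟨hrep₀R _ hS, ?_⟩
      -- `rep₀(r rb⁻¹) ∈ (r rb⁻¹)·N₀ ⊆ N′` since `r rb⁻¹ ∈ N′`
      have hn : r * rb⁻¹ ∈ N' := by
        have h := inv_mem (hrepN r (hR₀S r hr)); rw [hrr, mul_inv_rev, inv_inv] at h
        rwa [mul_comm] at h
      have h2 := hN₀ (hrep₀N _ hS)
      have : rep₀ (r * rb⁻¹) = (r * rb⁻¹) * ((r * rb⁻¹)⁻¹ * rep₀ (r * rb⁻¹)) := by group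
      rw [this]; exact mul_mem hn h2
    · rw [Finset.mem_filter] at hr₁ hr₂
      have hS₁ : r₁ * rb⁻¹ ∈ S := mul_mem (hR₀S r₁ hr₁.1) (inv_mem hrbS)
      have hS₂ : r₂ * rb⁻¹ ∈ S := mul_mem (hR₀S r₂ hr₂.1) (inv_mem hrbS)
      -- both `r₁`, `r₂` represent the `N₀`-class of `r₁`
      have h12 : r₁⁻¹ * r₂ ∈ N₀ := by
        have a := hrep₀N _ hS₁
        have b := hrep₀N _ hS₂
        rw [h] at a
        have : r₁⁻¹ * r₂ = ((r₁ * rb⁻¹)⁻¹ * rep₀ (r₂ * rb⁻¹)) * ((r₂ * rb⁻¹)⁻¹ * rep₀ (r₂ * rb⁻¹))⁻¹ := by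
          rw [hk1, inv_inv, hk2]
        rw [this]; exact mul_mem a (inv_mem b)
      have e1 := hrep₀_self r₁ hr₁.1
      have e2 := hrep₀_uniq r₁ (hR₀S r₁ hr₁.1) r₂ hr₂.1 h12
      rw [e2, e1]
    · rw [Finset.mem_filter] at hr'
      obtain ⟨hr', hr'N⟩ := hr'
      have hS : r' * rb ∈ S := mul_mem (hR₀S r' hr') hrbS
      refine ⟨rep₀ (r' * rb), ?_, ?_⟩
      · rw [Finset.mem_filter]
        refine ⟨hrep₀R _ hS, ?_⟩
        -- `rep₀(r' rb) ∈ r' rb N₀ ⊆ rb N′`, so its `R`-representative is `rb`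
        have hn : rb⁻¹ * rep₀ (r' * rb) ∈ N' := by
          have : rb⁻¹ * rep₀ (r' * rb) = r' * ((r' * rb)⁻¹ * rep₀ (r' * rb)) := by
            rw [mul_inv_rev, ← mul_assoc, ← mul_assoc, mul_comm r' rb⁻¹, mul_inv_cancel_right]
          rw [this]; exact mul_mem hr'N (hN₀ (hrep₀N _ hS))
        rw [hrep_eq_of rb hrbS _ (hR₀S _ (hrep₀R _ hS)) hn, hrep_self rb hrb]
      · -- `rep₀(rep₀(r' rb)·rb⁻¹) = r'`
        have hS' : rep₀ (r' * rb) * rb⁻¹ ∈ S := mul_mem (hR₀S _ (hrep₀R _ hS)) (inv_mem hrbS)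
        symm
        refine hrep₀_uniq _ hS' r' hr' ?_
        have : (rep₀ (r' * rb) * rb⁻¹)⁻¹ * r' = ((r' * rb)⁻¹ * rep₀ (r' * rb))⁻¹ := by
          simp only [mul_inv_rev, inv_inv, mul_comm, mul_assoc, mul_left_comm]
        rw [this]; exact inv_mem (hrep₀N _ hS)
  rw [Finset.sum_congr rfl hfib, ← Finset.mul_sum]

end Generic

/-! ## §2  HEAD — the class-sign labelled count over a transversal of a smaller subgroup -/

variable {K : Type} [Field K] [Valued K ℤᵐ⁰]
variable {σ : K →+* K} {ϖ : K} {tv : ℕ} {M₀ : Submodule 𝒪[K] (Fin 3 → K)} {D₁ : Fin 3 → K}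

open Classical in
/-- **HEAD — THE CLASS-SIGN COUNT OVER `R₀`, A TRANSVERSAL OF `S_F ∕ N₀`, `N₀ ≤ N(S̃′)`.**  ★ (L-lab-20b)'s setting (`hcoset`, class-sign label `Λ M₀ (D₁·u) ↔ λ u = 1`,
`λ ∈ {±1}` `N′`-invariant), a subgroup `N₀ ≤ N′ = N(S̃′(M₀))`, transversals `R` of `S_F ∕ N′` and `R₀` of `S_F ∕ N₀`.  Then
`2 · #(R₀ ∩ N′) · labelledOddCount σ ϖ tv i Λ M₀ = ω(D_{1,i}) · Σ_{r ∈ R₀} ω(r_i)·(1 + λ r)`  (`#(R₀ ∩ N′) = [N′ : N₀]`).  For the glued representative take `N₀` the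
PRODUCT norm subgroup (MEMO-B2b2 §3) and `R₀` a product of F-side representative systems. [cite: Kottwitz1986BaseChangeUnits, §1 pp. 240–241] [cite: LanglandsShelstad1987, §3] -/
theorem two_mul_card_mul_labelledOddCount_eq_sum_of_classSign {c : K} (hσc : σ c = c) (hc : ¬ ∃ z : K, z * σ z = c)
    (hdich : ∀ x : K, σ x = x → x ≠ 0 → (∃ z : K, z * σ z = x) ∨ ∃ z : K, z * σ z = c * x)
    (hD₁ : ∀ j, σ (D₁ j) = D₁ j ∧ D₁ j ≠ 0) (hV₁ : IsVertexLattice σ ϖ (Matrix.diagonal D₁) tv M₀) (hσ : ∀ x, σ (σ x) = x)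
    (hcoset : ∀ D : Fin 3 → K, (∀ j, σ (D j) = D j ∧ D j ≠ 0) →
      (IsVertexLattice σ ϖ (Matrix.diagonal D) tv M₀ ↔ ∃ u ∈ fixedUnitStabilizer σ M₀, ∀ j, D j = D₁ j * ((u j : Kˣ) : K)))
    (Λ : Submodule 𝒪[K] (Fin 3 → K) → (Fin 3 → K) → Prop) (i : Fin 3) {lam : (Fin 3 → Kˣ) → ℤ}
    (hlam : ∀ u ∈ fixedUnitStabilizer σ M₀, lam u = 1 ∨ lam u = -1)
    (hlamN : ∀ u ∈ fixedUnitStabilizer σ M₀, ∀ n ∈ (unitStabilizer M₀).map (unitNormMap σ 3), lam (u * n) = lam u)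
    (hΛ : ∀ u ∈ fixedUnitStabilizer σ M₀, Λ M₀ (fun j => D₁ j * ((u j : Kˣ) : K)) ↔ lam u = 1)
    (R : Finset (Fin 3 → Kˣ)) (hRS : ∀ r ∈ R, r ∈ fixedUnitStabilizer σ M₀)
    (hR : ∀ u ∈ fixedUnitStabilizer σ M₀, ∃! r, r ∈ R ∧ u⁻¹ * r ∈ (unitStabilizer M₀).map (unitNormMap σ 3))
    {N₀ : Subgroup (Fin 3 → Kˣ)} (hN₀ : N₀ ≤ (unitStabilizer M₀).map (unitNormMap σ 3))
    (R₀ : Finset (Fin 3 → Kˣ)) (hR₀S : ∀ r ∈ R₀, r ∈ fixedUnitStabilizer σ M₀)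
    (hR₀ : ∀ u ∈ fixedUnitStabilizer σ M₀, ∃! r, r ∈ R₀ ∧ u⁻¹ * r ∈ N₀) :
    2 * ((R₀.filter fun r => r ∈ (unitStabilizer M₀).map (unitNormMap σ 3)).card : ℤ) * labelledOddCount σ ϖ tv i Λ M₀ =
      normSign σ (D₁ i) * ∑ r ∈ R₀, normSign σ ((r i : Kˣ) : K) * (1 + lam r) := by
  classical
  have hF : ∀ u ∈ fixedUnitStabilizer σ M₀, ∀ n ∈ (unitStabilizer M₀).map (unitNormMap σ 3),
      normSign σ (((u * n) i : Kˣ) : K) * (1 + lam (u * n)) = normSign σ ((u i : Kˣ) : K) * (1 + lam u) := fun u hu n hn => by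
    rw [hlamN u hu n hn, Pi.mul_apply, Units.val_mul, normSign_mul_eq_of_mem_map_unitNormMap σ hn]
  have h20b := two_mul_labelledOddCount_eq_sum_of_classSign hσc hc hdich hD₁ hV₁ hσ hcoset Λ i hlam hlamN hΛ R hRS hR
  have hsum := sum_transversal_eq_card_mul_sum_transversal (S := fixedUnitStabilizer σ M₀) hN₀ R hRS hR R₀ hR₀S hR₀ (fun u => normSign σ ((u i : Kˣ) : K) * (1 + lam u)) hF
  calc 2 * (((R₀.filter fun r => r ∈ (unitStabilizer M₀).map (unitNormMap σ 3)).card : ℕ) : ℤ) * labelledOddCount σ ϖ tv i Λ M₀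
      = ((R₀.filter fun r => r ∈ (unitStabilizer M₀).map (unitNormMap σ 3)).card : ℤ) * (2 * labelledOddCount σ ϖ tv i Λ M₀) := by ring
    _ = ((R₀.filter fun r => r ∈ (unitStabilizer M₀).map (unitNormMap σ 3)).card : ℤ) *
          (normSign σ (D₁ i) * ∑ r ∈ R, normSign σ ((r i : Kˣ) : K) * (1 + lam r)) := by rw [h20b]
    _ = normSign σ (D₁ i) * (((R₀.filter fun r => r ∈ (unitStabilizer M₀).map (unitNormMap σ 3)).card : ℤ) *
          ∑ r ∈ R, normSign σ ((r i : Kˣ) : K) * (1 + lam r)) := by ring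
    _ = normSign σ (D₁ i) * ∑ r ∈ R₀, normSign σ ((r i : Kˣ) : K) * (1 + lam r) := by rw [← hsum]

end Summit.HodgeConjecture.HodgeConjecture.Cruxes.H413.F0P3cDyRamLabelledOddClassSignSubgroup

end
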